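import Literature.NumberTheory.LFunctions.DobnerSelbergClassDeformed
import Literature.NumberTheory.LFunctions.DobnerLemma3Proofs
import Literature.Analysis.SpecialFunctions.GammaStirlingVertical
import Mathlib.NumberTheory.LSeries.Injectivity
import HarnessLib

/-!
# Dobner's Lemma 3 for the extended Selberg class: `F_t` has a zero (`t < 0`)

RH-FREE literature proofs (no new facts, no `def`s). Trunk T-ANT
(`Literature/NumberTheory/LFunctions`); companion of `DobnerSelbergClass.lean` (the class `𝒮♯`,
Dobner's Theorems 1/2), `DobnerSelbergClassDeformed.lean` (the deformed series `F_t`) and of the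
`ζ`-case `DobnerLemma3Proofs.lean`, whose generic complex-analysis lemmas
(`Literature.NumberTheory.LFunctions.exists_entire_log`,
`Literature.NumberTheory.LFunctions.exists_norm_le_sq_of_re_le`,
`Literature.NumberTheory.LFunctions.iteratedDeriv_three_eq_zero`,
`Literature.NumberTheory.LFunctions.eq_quadratic_of_iteratedDeriv_three`,
`Literature.NumberTheory.LFunctions.quadratic_coeffs_of_bounded`) are reused verbatim.

> A. Dobner, *A proof of Newman's conjecture for the extended Selberg class*, Acta Arith. 201
> (2021) = arXiv:2005.05142. **Lemma 3** (§3, p. 9 of the held arXiv text): "For any `t < 0`,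
> `F_t` has a zero." (here `F_t(s) = ∑ exp(−(|t|/4) log² n) aₙ n^{−s}` is the deformed series of
> `F ∈ 𝒮♯` from Thm. 4, p. 8); proof in §5, p. 16: "`|F_t(x+iy)| ≤ F̃_t(x) ≪ exp((10/|t|)
> min(x,−2)²)`, so `F_t` is of order at most two. Now suppose for the sake of contradiction that
> `F_t` has no zeros. Then by the Hadamard factorization theorem, `F_t(s) = exp(P(s))` where `P` is
> a polynomial of degree at most two. Using the fact that `F_t(s)` is uniformly bounded in all
> half-planes `{Re s > c}`, one may verify that the only possible choices for `P(s)` are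
> `P(s) = −λs + ρ` where `λ ≥ 0`, `ρ ∈ ℂ`. Hence `∑ exp(−(|t|/4) log² n) aₙ n^{−s} = e^ρ exp(−λs)`
> for all `s ∈ ℂ`. Now note that the righthand side of this equality is a (generalized) Dirichlet
> series with only one term, so such an equality is impossible by the uniqueness of coefficients
> of generalized Dirichlet series."

## Main result

* `Literature.NumberTheory.LFunctions.ExtendedSelbergDatum.Ft_exists_zero`: for a datum `D` of
  `𝒮♯` with `0 < D.numGamma` and every `t < 0`, `∃ s, D.Ft t s = 0` — Lemma 3 as printed, for
  the whole class `𝒮♯` (the tree's `Literature.NumberTheory.LFunctions.dobner_zetaDeformed_exists_zero`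
  / `…_holds` in `DobnerNewman.lean` / `DobnerLemma3Proofs.lean` is the case `F = ζ`); node N3
  of the t7 architecture note for `Literature.NumberTheory.LFunctions.dobner_theorem2`
  (rt/STATUS 2026-08-26).

## The printed proof and this port

The port follows the printed proof (growth of order `≤ 2` + boundedness on right half-planes ⇒
a zero-free `F_t` is `e^{ρ − λs}`, `λ` real ⇒ contradiction with uniqueness of Dirichlet
coefficients), with Borel–Carathéodory + Cauchy estimates in place of Hadamard's factorization
theorem exactly as in the `ζ`-case file `DobnerLemma3Proofs.lean` (PROOF-ROUTE divergence, same as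
there). Two inputs are specific to general `F ∈ 𝒮♯` and proved here:

1. *growth*: `‖F_t(s)‖ ≤ S e^{(4/|t|)‖s‖²}` and boundedness on right half-planes
   (`exists_norm_Ft_le_exp_sq`, `exists_norm_Ft_le_of_le_re`), from `aₙ = O(n²)`
   (`Literature.NumberTheory.LFunctions.ExtendedSelbergDatum.coeff_isBigO_sq`) by termwise
   comparison with `ζ_t(s − 2)` (the source's `F̃_t(x) ≪ exp((10/|t|) min(x,−2)²)`);
2. *at least two non-zero coefficients* (`exists_coeff_ne_zero_ne`). The last sentence of the
   printed proof uses this tacitly: `e^ρ e^{−λs}` is itself a one-term generalized Dirichlet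
   series, so uniqueness of coefficients yields a contradiction only if `F_t` (equivalently `F`)
   has two non-zero coefficients. Proof: if `F(s) = a n₀^{−s}` then the functional equation (iii)
   on the lines `Re s = ¼`, `¾` makes `∑ᵢ (log|Γ(ωᵢ(¾+iy)+μᵢ)| − log|Γ(ωᵢ(¼+iy)+μᵢ)|)` constant
   in `y` (the factors `sᵐ(s−1)ᵐ` cancel between the two lines and `Qˢ` contributes a constant),
   whereas by Stirling on vertical strips
   (`Literature.Analysis.SpecialFunctions.GammaStirling.exists_abs_log_norm_Gamma_vertical_sub_le`)
   it is `≥ (∑ωᵢ/2) log y − O(1) → ∞`. This is where `k ≥ 1` enters: for `k = 0`, `F = 1 ∈ 𝒮♯`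
   and `F_t = 1` has no zero (item 3 of the module docstring of `DobnerSelbergClass.lean`), so
   the hypothesis `0 < D.numGamma` cannot be dropped.

With these, a zero-free `F_t` equals `e^{ρ + bs}` with `b` real
(`Literature.NumberTheory.LFunctions.quadratic_coeffs_of_bounded`); multiplying by `n₁ˢ` (`n₁` the
first non-zero coefficient) and letting `s → +∞` along the reals (`LSeries.tendsto_cpow_mul_atTop`)
gives `b = −log n₁` and `F_t(s) = a_{n₁} e^{(t/4)log² n₁} n₁^{−s}`, so by uniqueness of Dirichlet
coefficients (`LSeries.eq_of_LSeries_eventually_eq`) all other coefficients vanish, contradicting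
input 2.

bears_on: N-C/N-P (COLUMN 3 DBN). WHAT THIS IS NOT: nothing here bears on the truth of RH.
-/

noncomputable section

open Complex Filter Set Asymptotics
open Literature.Analysis.SpecialFunctions
open scoped ComplexConjugate

namespace Literature.NumberTheory.LFunctions

namespace ExtendedSelbergDatum

variable (D : ExtendedSelbergDatum)

/-! ### Growth of `F_t` -/

/-- A global form of `aₙ = O(n²)`: `‖aₙ‖ ≤ C n²` for all `n ≥ 1`. [cite: Dobner2021, §2 p. 5 ("aₙ = O(n²)")] -/
theorem exists_norm_coeff_le : ∃ C : ℝ, 0 < C ∧ ∀ n : ℕ, n ≠ 0 → ‖D.coeff n‖ ≤ C * (n : ℝ) ^ 2 := by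
  obtain ⟨C, hC0, hC⟩ := bound_of_isBigO_nat_atTop D.coeff_isBigO_sq
  refine ⟨C, hC0, fun n hn ↦ ?_⟩
  have h := hC (x := n) (by positivity)
  rwa [Real.norm_of_nonneg (by positivity)] at h

/-- Termwise domination of `F_t` by `ζ_t` two units to the left, for ALL `n`:
`‖term (deformedCoeff t) s n‖ ≤ C ‖term (zetaDeformedCoeff t) (s − 2) n‖`. [cite: Dobner2021, §3.1 p. 8] -/
theorem exists_norm_term_le (t : ℝ) : ∃ C : ℝ, 0 < C ∧ ∀ (s : ℂ) (n : ℕ),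
    ‖LSeries.term (D.deformedCoeff t) s n‖ ≤ C * ‖LSeries.term (zetaDeformedCoeff t) (s - 2) n‖ := by
  obtain ⟨C, hC0, hC⟩ := D.exists_norm_coeff_le
  refine ⟨C, hC0, fun s n ↦ ?_⟩
  rcases Nat.eq_zero_or_pos n with rfl | hn
  · simp
  have hnpos : (0 : ℝ) < n := by exact_mod_cast hn
  rw [LSeries.term_of_ne_zero hn.ne', LSeries.term_of_ne_zero hn.ne', deformedCoeff, norm_div,
    norm_div, norm_mul, Complex.norm_natCast_cpow_of_pos hn, Complex.norm_natCast_cpow_of_pos hn,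
    Complex.sub_re, show (2 : ℂ).re = 2 by norm_num, Real.rpow_sub hnpos, Real.rpow_two,
    div_div_eq_mul_div]
  have := hC n hn.ne'
  have h0 : 0 ≤ ‖zetaDeformedCoeff t n‖ := norm_nonneg _
  have hns : (0 : ℝ) < (n : ℝ) ^ s.re := Real.rpow_pos_of_pos hnpos _
  calc ‖zetaDeformedCoeff t n‖ * ‖D.coeff n‖ / (n : ℝ) ^ s.re
      ≤ ‖zetaDeformedCoeff t n‖ * (C * (n : ℝ) ^ 2) / (n : ℝ) ^ s.re := by gcongr
    _ = C * (‖zetaDeformedCoeff t n‖ * (n : ℝ) ^ 2 / (n : ℝ) ^ s.re) := by ring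

/-- `F_t` (`t < 0`) is bounded on every right half-plane `Re s ≥ c`.
[cite: Dobner2021, §5 p. 16 (proof of Lemma 3)] -/
theorem exists_norm_Ft_le_of_le_re {t : ℝ} (ht : t < 0) (c : ℝ) :
    ∃ B : ℝ, ∀ s : ℂ, c ≤ s.re → ‖D.Ft t s‖ ≤ B := by
  obtain ⟨C, hC0, hC⟩ := D.exists_norm_term_le t
  refine ⟨C * ∑' n : ℕ, ‖LSeries.term (zetaDeformedCoeff t) ((c - 2 : ℝ) : ℂ) n‖, fun s hs ↦ ?_⟩
  rw [Ft, LSeries]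
  refine (norm_tsum_le_tsum_norm (D.summable_deformedCoeff ht s).norm).trans ?_
  have h1 : ∑' n, ‖LSeries.term (D.deformedCoeff t) s n‖ ≤
      ∑' n, C * ‖LSeries.term (zetaDeformedCoeff t) (s - 2) n‖ :=
    Summable.tsum_le_tsum (hC s) (D.summable_deformedCoeff ht s).norm
      ((zetaDeformed_summable ht _).norm.mul_left C)
  refine h1.trans ?_
  rw [tsum_mul_left]
  refine mul_le_mul_of_nonneg_left ?_ hC0.le
  refine Summable.tsum_le_tsum (fun n ↦ ?_) (zetaDeformed_summable ht _).norm
    (zetaDeformed_summable ht _).norm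
  exact norm_term_zetaDeformed_le_of_le_re t (by simp; linarith) n

/-- Termwise Gaussian bound for `ζ_t`: `‖term (zetaDeformedCoeff t) s n‖ ≤
e^{(2/|t|)(Re s)²} ‖term (zetaDeformedCoeff (t/2)) 0 n‖` (AM–GM in the exponent).
[cite: Dobner2021, §5 p. 16 (proof of Lemma 3: "of order at most two")] -/
theorem norm_term_zetaDeformed_le_exp_sq {t : ℝ} (ht : t < 0) (s : ℂ) (n : ℕ) :
    ‖LSeries.term (zetaDeformedCoeff t) s n‖ ≤
      Real.exp (2 / |t| * s.re ^ 2) * ‖LSeries.term (zetaDeformedCoeff (t / 2)) 0 n‖ := by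
  rcases Nat.eq_zero_or_pos n with rfl | hn
  · simp
  have hnpos : (0 : ℝ) < n := by exact_mod_cast hn
  have habs : |t| = -t := abs_of_neg ht
  rw [LSeries.term_of_ne_zero hn.ne', LSeries.term_of_ne_zero hn.ne', norm_div, norm_div,
    Complex.norm_natCast_cpow_of_pos hn, Complex.norm_natCast_cpow_of_pos hn, zetaDeformedCoeff,
    zetaDeformedCoeff, Complex.norm_real, Complex.norm_real, Real.norm_eq_abs, Real.norm_eq_abs,
    abs_of_pos (Real.exp_pos _), abs_of_pos (Real.exp_pos _), Complex.zero_re, Real.rpow_zero,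
    div_one, div_eq_mul_inv, ← Real.rpow_neg hnpos.le, Real.rpow_def_of_pos hnpos,
    ← Real.exp_add, ← Real.exp_add]
  apply Real.exp_le_exp.2
  set L := Real.log n
  set x := s.re
  rw [habs]
  have ht' : 0 < -t := by linarith
  have htne : t ≠ 0 := ht.ne
  have key : -(x * L) ≤ 2 / -t * x ^ 2 + -t / 8 * L ^ 2 := by
    have hsq : 0 ≤ (2 / -t) * (x + (-t) / 4 * L) ^ 2 := by positivity
    have e : (2 / -t) * (x + (-t) / 4 * L) ^ 2 = 2 / -t * x ^ 2 + x * L + -t / 8 * L ^ 2 := by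
      field_simp
      ring
    linarith
  have e1 : t / 4 * L ^ 2 + L * -x = (t / 8 * L ^ 2) + (-(x * L) + -(-t / 8 * L ^ 2)) := by ring
  have e2 : t / 2 / 4 * L ^ 2 = t / 8 * L ^ 2 := by ring
  rw [e1, e2]
  linarith

/-- `F_t` (`t < 0`) has order at most two: `‖F_t(s)‖ ≤ S e^{(4/|t|)‖s‖²}` for some `S > 0`.
[cite: Dobner2021, §5 p. 16 (proof of Lemma 3: "of order at most two")] -/
theorem exists_norm_Ft_le_exp_sq {t : ℝ} (ht : t < 0) :
    ∃ S : ℝ, 0 < S ∧ ∀ s : ℂ, ‖D.Ft t s‖ ≤ S * Real.exp (4 / |t| * ‖s‖ ^ 2) := by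
  obtain ⟨C, hC0, hC⟩ := D.exists_norm_term_le t
  have ht2 : t / 2 < 0 := by linarith
  set S₀ : ℝ := ∑' n : ℕ, ‖LSeries.term (zetaDeformedCoeff (t / 2)) 0 n‖ with hS₀
  have hS₀sum := (zetaDeformed_summable ht2 0).norm
  have hS₀0 : 0 ≤ S₀ := tsum_nonneg fun n ↦ norm_nonneg _
  have htpos : 0 < |t| := abs_pos.2 ht.ne
  refine ⟨C * Real.exp (16 / |t|) * (S₀ + 1), by positivity, fun s ↦ ?_⟩
  rw [Ft, LSeries]
  refine (norm_tsum_le_tsum_norm (D.summable_deformedCoeff ht s).norm).trans ?_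
  have hterm : ∀ n : ℕ, ‖LSeries.term (D.deformedCoeff t) s n‖ ≤
      C * Real.exp (2 / |t| * (s.re - 2) ^ 2) * ‖LSeries.term (zetaDeformedCoeff (t / 2)) 0 n‖ := by
    intro n
    refine (hC s n).trans ?_
    rw [mul_assoc]
    refine mul_le_mul_of_nonneg_left ?_ hC0.le
    have := norm_term_zetaDeformed_le_exp_sq ht (s - 2) n
    simpa using this
  calc ∑' n, ‖LSeries.term (D.deformedCoeff t) s n‖
      ≤ ∑' n, C * Real.exp (2 / |t| * (s.re - 2) ^ 2) * ‖LSeries.term (zetaDeformedCoeff (t / 2)) 0 n‖ :=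
        Summable.tsum_le_tsum hterm (D.summable_deformedCoeff ht s).norm (hS₀sum.mul_left _)
    _ = C * Real.exp (2 / |t| * (s.re - 2) ^ 2) * S₀ := by rw [tsum_mul_left]
    _ ≤ C * (Real.exp (16 / |t|) * Real.exp (4 / |t| * ‖s‖ ^ 2)) * (S₀ + 1) := by
        have hsq : (s.re - 2) ^ 2 ≤ 2 * ‖s‖ ^ 2 + 8 := by
          have h1 : s.re ^ 2 ≤ ‖s‖ ^ 2 :=
            sq_le_sq' (by linarith [abs_re_le_norm s, neg_abs_le s.re]) (Complex.re_le_norm s)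
          nlinarith [sq_nonneg (s.re + 2)]
        have hexp : Real.exp (2 / |t| * (s.re - 2) ^ 2) ≤
            Real.exp (16 / |t|) * Real.exp (4 / |t| * ‖s‖ ^ 2) := by
          rw [← Real.exp_add]
          apply Real.exp_le_exp.2
          have := mul_le_mul_of_nonneg_left hsq (show 0 ≤ 2 / |t| by positivity)
          have e : 2 / |t| * (2 * ‖s‖ ^ 2 + 8) = 16 / |t| + 4 / |t| * ‖s‖ ^ 2 := by ring
          linarith
        have h3 : 0 ≤ C * Real.exp (2 / |t| * (s.re - 2) ^ 2) := by positivity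
        calc C * Real.exp (2 / |t| * (s.re - 2) ^ 2) * S₀
            ≤ C * Real.exp (2 / |t| * (s.re - 2) ^ 2) * (S₀ + 1) := by nlinarith
          _ ≤ C * (Real.exp (16 / |t|) * Real.exp (4 / |t| * ‖s‖ ^ 2)) * (S₀ + 1) := by
              gcongr
    _ = C * Real.exp (16 / |t|) * (S₀ + 1) * Real.exp (4 / |t| * ‖s‖ ^ 2) := by ring


/-! ### An element of `𝒮♯` with `k ≥ 1` has at least two non-zero coefficients -/

/-- Norm of `γ(w)` as a product of norms. [cite: Dobner2021, §2 (iii) p. 5] -/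
theorem norm_gamma_eq (w : ℂ) : ‖D.gamma w‖ = ‖D.alpha‖ * ‖w‖ ^ D.polarOrder * ‖w - 1‖ ^ D.polarOrder *
    D.Q ^ w.re * ∏ i, ‖Complex.Gamma ((D.omega i : ℂ) * w + D.mu i)‖ := by
  rw [gamma, dobnerGamma_apply, norm_mul, norm_mul, norm_mul, norm_mul, norm_pow, norm_pow,
    Complex.norm_cpow_eq_rpow_re_of_pos D.Q_pos, norm_prod]

/-- The arguments of the `Γ`-factors on the lines `Re w = x`: real/imaginary split. [folklore] -/
private theorem omega_mul_add_mu_eq (i : Fin D.numGamma) (x y : ℝ) :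
    (D.omega i : ℂ) * ((x : ℂ) + y * I) + D.mu i =
      ((D.omega i * x + (D.mu i).re : ℝ) : ℂ) + ((D.omega i * y + (D.mu i).im : ℝ) : ℂ) * I := by
  apply Complex.ext <;> simp

/-- If all coefficients other than `a_{n₀}` vanish, then `F(s) = term n₀` off `s = 1`
(identity theorem for the entire continuation `G`). [cite: Dobner2021, §2 (ii) p. 5] -/
theorem toFun_eq_term_of_coeff_eq_zero {n₀ : ℕ} (H : ∀ n : ℕ, n ≠ 0 → n ≠ n₀ → D.coeff n = 0)
    {s : ℂ} (hs : s ≠ 1) : D.toFun s = LSeries.term D.coeff s n₀ := by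
  obtain ⟨G, hGd, hG, -⟩ := D.differentiable
  -- the entire single-term function
  set E : ℂ → ℂ := fun s ↦ (s - 1) ^ D.polarOrder * LSeries.term D.coeff s n₀ with hE
  have hEd : Differentiable ℂ E := by
    have hterm : Differentiable ℂ fun s : ℂ ↦ LSeries.term D.coeff s n₀ := by
      rcases Nat.eq_zero_or_pos n₀ with h0 | hpos
      · simp only [h0, LSeries.term_zero]; exact differentiable_const _
      · have hn0' : (n₀ : ℂ) ≠ 0 := by exact_mod_cast hpos.ne'
        have : (fun s : ℂ ↦ LSeries.term D.coeff s n₀) = fun s ↦ D.coeff n₀ * (n₀ : ℂ) ^ (-s) := by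
          funext s; rw [LSeries.term_of_ne_zero hpos.ne', Complex.cpow_neg, div_eq_mul_inv]
        rw [this]
        exact (differentiable_id.neg.const_cpow (Or.inl hn0')).const_mul _
    exact ((differentiable_id.sub_const 1).pow _).mul hterm
  -- `LSeries coeff = term n₀` on `Re s > 1`
  have hL : ∀ s : ℂ, 1 < s.re → LSeries D.coeff s = LSeries.term D.coeff s n₀ := by
    intro s hs
    rw [LSeries]
    refine tsum_eq_single n₀ fun n hn ↦ ?_
    rcases Nat.eq_zero_or_pos n with h0 | hpos
    · rw [h0, LSeries.term_zero]
    · rw [LSeries.term_of_ne_zero hpos.ne', H n hpos.ne' hn, zero_div]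
  -- `G = E` on `Re s > 1`, hence everywhere
  have hGE : ∀ s : ℂ, G s = E s := by
    have hev : G =ᶠ[nhds (2 : ℂ)] E := by
      have ho : IsOpen {z : ℂ | 1 < z.re} := isOpen_lt continuous_const Complex.continuous_re
      filter_upwards [ho.mem_nhds (show (1 : ℝ) < (2 : ℂ).re by norm_num)] with z hz
      have hz1 : z ≠ 1 := fun h ↦ by rw [h] at hz; norm_num at hz
      simp only [hE]
      rw [hG z hz1, D.eqOn_LSeries hz, hL z hz]
    have h := AnalyticOnNhd.eqOn_of_preconnected_of_eventuallyEq
      (Complex.analyticOnNhd_univ_iff_differentiable.2 hGd)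
      (Complex.analyticOnNhd_univ_iff_differentiable.2 hEd) isPreconnected_univ (mem_univ 2) hev
    exact fun s ↦ h (mem_univ s)
  have h1 := hG s hs
  rw [hGE s] at h1
  simp only [hE] at h1
  have hne : (s - 1) ^ D.polarOrder ≠ 0 := pow_ne_zero _ (sub_ne_zero.2 hs)
  exact (mul_left_cancel₀ hne h1).symm

/-- **At least two non-zero coefficients.** For `F ∈ 𝒮♯` with at least one `Γ`-factor and any
`n₀`, some coefficient `aₙ`, `n ∉ {0, n₀}`, is non-zero: otherwise `F(s) = a n₀^{−s}`, and the
functional equation on the lines `Re s = ¼, ¾` would force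
`∑ᵢ (log|Γ(ωᵢ(¾+iy)+μᵢ)| − log|Γ(ωᵢ(¼+iy)+μᵢ)|)` to be constant in `y`, while by Stirling it grows
like `(∑ωᵢ/2) log y`. (Tacit in the last sentence of the printed proof of Lemma 3, §5 p. 16: the
one-term series `e^ρ e^{−λs}` contradicts uniqueness of generalized Dirichlet coefficients only
if `F` has two non-zero coefficients.) [cite: Dobner2021, §5 p. 16 (proof of Lemma 3)] -/
theorem exists_coeff_ne_zero_ne (hk : 0 < D.numGamma) (n₀ : ℕ) :
    ∃ n : ℕ, n ≠ 0 ∧ n ≠ n₀ ∧ D.coeff n ≠ 0 := by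
  by_contra hcon
  push Not at hcon
  have H : ∀ n : ℕ, n ≠ 0 → n ≠ n₀ → D.coeff n = 0 := fun n h1 h2 ↦ hcon n h1 h2
  have hF := fun s hs ↦ D.toFun_eq_term_of_coeff_eq_zero H (s := s) hs
  -- the single term must be non-trivial
  obtain ⟨s₁, hs₁, hFs₁⟩ := D.exists_ne_zero
  have hn₀ : n₀ ≠ 0 := by
    intro h0
    apply hFs₁
    rw [hF s₁ hs₁, h0, LSeries.term_zero]
  set a : ℂ := D.coeff n₀ with ha
  have ha0 : a ≠ 0 := by
    intro h0
    apply hFs₁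
    rw [hF s₁ hs₁, LSeries.term_of_ne_zero hn₀, ← ha, h0, zero_div]
  have hn₀pos : 0 < n₀ := Nat.pos_of_ne_zero hn₀
  have hn₀r : (0 : ℝ) < n₀ := by exact_mod_cast hn₀pos
  -- Stirling constants for each factor on `x ∈ [ω/4 + Re μ, 3ω/4 + Re μ]`
  have hC : ∀ i : Fin D.numGamma, ∃ C : ℝ, 0 ≤ C ∧
      ∀ x ∈ Icc (D.omega i / 4 + (D.mu i).re) (3 * D.omega i / 4 + (D.mu i).re), ∀ u : ℝ, 1 ≤ |u| →
        |Real.log ‖Complex.Gamma ((x : ℂ) + u * I)‖ - ((x - 1 / 2) * Real.log |u| - Real.pi * |u| / 2)| ≤ C :=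
    fun i ↦ GammaStirling.exists_abs_log_norm_Gamma_vertical_sub_le _ _
  choose C hC0 hC using hC
  -- the constant the sum of `Γ`-differences would have to equal
  set K₀ : ℝ := 1 / 2 * Real.log n₀ - 1 / 2 * Real.log D.Q with hK₀
  set M : ℝ := max (K₀ + 1) 0 with hM
  -- choose `y` large
  have hev : ∀ i : Fin D.numGamma, ∀ᶠ y : ℝ in atTop,
      1 ≤ |D.omega i * y + (D.mu i).im| ∧
        M ≤ D.omega i / 2 * Real.log |D.omega i * y + (D.mu i).im| - 2 * C i := by
    intro i
    have hlin : Tendsto (fun y : ℝ ↦ D.omega i * y + (D.mu i).im) atTop atTop :=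
      tendsto_atTop_add_const_right _ _ (tendsto_id.const_mul_atTop (D.omega_pos i))
    have habs : Tendsto (fun y : ℝ ↦ |D.omega i * y + (D.mu i).im|) atTop atTop :=
      tendsto_abs_atTop_atTop.comp hlin
    have hlog : Tendsto (fun y : ℝ ↦ D.omega i / 2 * Real.log |D.omega i * y + (D.mu i).im| - 2 * C i)
        atTop atTop := by
      refine tendsto_atTop_add_const_right _ _ (Tendsto.const_mul_atTop (by
        have := D.omega_pos i; positivity) (Real.tendsto_log_atTop.comp habs))
    exact (habs.eventually_ge_atTop 1).and (hlog.eventually_ge_atTop M)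
  obtain ⟨y, hy⟩ := ((eventually_all.2 hev).and (eventually_ge_atTop (1 : ℝ))).exists
  obtain ⟨hyall, hy1⟩ := hy
  -- the two points
  set u : ℂ := ((3 / 4 : ℝ) : ℂ) + y * I with hu
  set v : ℂ := ((1 / 4 : ℝ) : ℂ) + y * I with hv
  have hu_re : u.re = 3 / 4 := by simp [hu]
  have hv_re : v.re = 1 / 4 := by simp [hv]
  have hu_im : u.im = y := by simp [hu]
  have hv_im : v.im = y := by simp [hv]
  have hconj : 1 - conj u = v := by
    apply Complex.ext
    · rw [Complex.sub_re, Complex.one_re, Complex.conj_re, hu_re, hv_re]; norm_num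
    · rw [Complex.sub_im, Complex.one_im, Complex.conj_im, hu_im, hv_im]; ring
  have hu1 : u ≠ 1 := fun h ↦ by have := congrArg Complex.im h; rw [hu_im] at this; simp at this; linarith
  have hv1 : v ≠ 1 := fun h ↦ by have := congrArg Complex.im h; rw [hv_im] at this; simp at this; linarith
  -- the functional equation at `u`, in norms
  have hFE := D.functional_equation u (by rw [hu_re]; norm_num) (by rw [hu_re]; norm_num)
  rw [hconj] at hFE
  have hFE' : ‖D.gamma u‖ * ‖D.toFun u‖ = ‖D.gamma v‖ * ‖D.toFun v‖ := by
    have := congrArg (fun z : ℂ ↦ ‖z‖) hFE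
    simpa only [norm_mul, Complex.norm_conj, gamma] using this
  have hFu : ‖D.toFun u‖ = ‖a‖ * (n₀ : ℝ) ^ (-(3 / 4 : ℝ)) := by
    rw [hF u hu1, LSeries.term_of_ne_zero hn₀, norm_div, Complex.norm_natCast_cpow_of_pos hn₀pos,
      hu_re, Real.rpow_neg hn₀r.le, div_eq_mul_inv]
  have hFv : ‖D.toFun v‖ = ‖a‖ * (n₀ : ℝ) ^ (-(1 / 4 : ℝ)) := by
    rw [hF v hv1, LSeries.term_of_ne_zero hn₀, norm_div, Complex.norm_natCast_cpow_of_pos hn₀pos,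
      hv_re, Real.rpow_neg hn₀r.le, div_eq_mul_inv]
  -- non-vanishing of the factors of `γ` at `u`, `v`
  have him_ne : ∀ i, D.omega i * y + (D.mu i).im ≠ 0 := fun i ↦ by
    intro h; have := (hyall i).1; rw [h, abs_zero] at this; linarith
  have hΓne : ∀ (x : ℝ) (i : Fin D.numGamma),
      Complex.Gamma ((D.omega i : ℂ) * ((x : ℂ) + y * I) + D.mu i) ≠ 0 := by
    intro x i
    rw [omega_mul_add_mu_eq]
    refine Complex.Gamma_ne_zero fun m hm ↦ ?_
    have := congrArg Complex.im hm
    simp at this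
    exact him_ne i this
  have hnorm_pos : ∀ {x : ℝ}, x ≠ 0 → x ≠ 1 → 0 < ‖D.gamma ((x : ℂ) + y * I)‖ := by
    intro x hx0 hx1
    rw [norm_gamma_eq]
    have hw0 : ((x : ℂ) + y * I) ≠ 0 := fun h ↦ by
      have := congrArg Complex.im h; simp at this; linarith
    have hw1 : ((x : ℂ) + y * I) - 1 ≠ 0 := fun h ↦ by
      have := congrArg Complex.im h; simp at this; linarith
    have h1 : 0 < ‖D.alpha‖ := norm_pos_iff.2 D.alpha_ne_zero
    have h2 : 0 < ‖(x : ℂ) + y * I‖ ^ D.polarOrder := pow_pos (norm_pos_iff.2 hw0) _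
    have h3 : 0 < ‖(x : ℂ) + y * I - 1‖ ^ D.polarOrder := pow_pos (norm_pos_iff.2 hw1) _
    have h4 : 0 < D.Q ^ ((x : ℂ) + y * I).re := Real.rpow_pos_of_pos D.Q_pos _
    have h5 : 0 < ∏ i, ‖Complex.Gamma ((D.omega i : ℂ) * ((x : ℂ) + y * I) + D.mu i)‖ :=
      Finset.prod_pos fun i _ ↦ norm_pos_iff.2 (hΓne x i)
    positivity
  have hγu : 0 < ‖D.gamma u‖ := hnorm_pos (by norm_num) (by norm_num)
  have hγv : 0 < ‖D.gamma v‖ := hnorm_pos (by norm_num) (by norm_num)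
  -- `log ‖γ u‖ − log ‖γ v‖ = ½ log n₀`
  have hlogeq : Real.log ‖D.gamma u‖ - Real.log ‖D.gamma v‖ = 1 / 2 * Real.log n₀ := by
    rw [hFu, hFv] at hFE'
    have ha' : 0 < ‖a‖ := norm_pos_iff.2 ha0
    have e1 : Real.log (‖D.gamma u‖ * (‖a‖ * (n₀ : ℝ) ^ (-(3 / 4 : ℝ)))) =
        Real.log ‖D.gamma u‖ + Real.log ‖a‖ + -(3 / 4 : ℝ) * Real.log n₀ := by
      rw [Real.log_mul hγu.ne' (by positivity), Real.log_mul ha'.ne' (by positivity),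
        Real.log_rpow hn₀r]; ring
    have e2 : Real.log (‖D.gamma v‖ * (‖a‖ * (n₀ : ℝ) ^ (-(1 / 4 : ℝ)))) =
        Real.log ‖D.gamma v‖ + Real.log ‖a‖ + -(1 / 4 : ℝ) * Real.log n₀ := by
      rw [Real.log_mul hγv.ne' (by positivity), Real.log_mul ha'.ne' (by positivity),
        Real.log_rpow hn₀r]; ring
    have := congrArg Real.log hFE'
    rw [e1, e2] at this
    linarith
  -- expand `log ‖γ‖` at `u` and `v`
  have hlogγ : ∀ {x : ℝ}, x ≠ 0 → x ≠ 1 → Real.log ‖D.gamma ((x : ℂ) + y * I)‖ =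
      Real.log ‖D.alpha‖ + D.polarOrder * Real.log ‖(x : ℂ) + y * I‖ +
        D.polarOrder * Real.log ‖(x : ℂ) + y * I - 1‖ + x * Real.log D.Q +
        ∑ i, Real.log ‖Complex.Gamma ((D.omega i : ℂ) * ((x : ℂ) + y * I) + D.mu i)‖ := by
    intro x hx0 hx1
    have hw0 : ((x : ℂ) + y * I) ≠ 0 := fun h ↦ by
      have := congrArg Complex.im h; simp at this; linarith
    have hw1 : ((x : ℂ) + y * I) - 1 ≠ 0 := fun h ↦ by
      have := congrArg Complex.im h; simp at this; linarith
    rw [norm_gamma_eq, Real.log_mul, Real.log_mul, Real.log_mul, Real.log_mul, Real.log_pow,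
      Real.log_pow, Real.log_rpow D.Q_pos, Real.log_prod]
    · simp
    · intro i _; exact (norm_pos_iff.2 (hΓne x i)).ne'
    · exact (norm_pos_iff.2 D.alpha_ne_zero).ne'
    · exact pow_ne_zero _ (norm_ne_zero_iff.2 hw0)
    · exact mul_ne_zero (norm_pos_iff.2 D.alpha_ne_zero).ne' (pow_ne_zero _ (norm_ne_zero_iff.2 hw0))
    · exact pow_ne_zero _ (norm_ne_zero_iff.2 hw1)
    · exact mul_ne_zero (mul_ne_zero (norm_pos_iff.2 D.alpha_ne_zero).ne'
        (pow_ne_zero _ (norm_ne_zero_iff.2 hw0))) (pow_ne_zero _ (norm_ne_zero_iff.2 hw1))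
    · exact (Real.rpow_pos_of_pos D.Q_pos _).ne'
    · refine mul_ne_zero (mul_ne_zero (mul_ne_zero (norm_pos_iff.2 D.alpha_ne_zero).ne'
        (pow_ne_zero _ (norm_ne_zero_iff.2 hw0))) (pow_ne_zero _ (norm_ne_zero_iff.2 hw1))) ?_
      exact (Real.rpow_pos_of_pos D.Q_pos _).ne'
    · exact Finset.prod_ne_zero_iff.2 fun i _ ↦ (norm_pos_iff.2 (hΓne x i)).ne'
  -- the polynomial factors cancel: `‖u‖ = ‖v − 1‖`, `‖u − 1‖ = ‖v‖`
  have hsym1 : ‖u‖ = ‖v - 1‖ := by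
    have : v - 1 = -(conj u) := by
      apply Complex.ext
      · rw [Complex.sub_re, Complex.one_re, Complex.neg_re, Complex.conj_re, hu_re, hv_re]; norm_num
      · rw [Complex.sub_im, Complex.one_im, Complex.neg_im, Complex.conj_im, hu_im, hv_im]; ring
    rw [this, norm_neg, Complex.norm_conj]
  have hsym2 : ‖u - 1‖ = ‖v‖ := by
    have : u - 1 = -(conj v) := by
      apply Complex.ext
      · rw [Complex.sub_re, Complex.one_re, Complex.neg_re, Complex.conj_re, hu_re, hv_re]; norm_num
      · rw [Complex.sub_im, Complex.one_im, Complex.neg_im, Complex.conj_im, hu_im, hv_im]; ring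
    rw [this, norm_neg, Complex.norm_conj]
  have hsum : ∑ i, (Real.log ‖Complex.Gamma ((D.omega i : ℂ) * u + D.mu i)‖ -
      Real.log ‖Complex.Gamma ((D.omega i : ℂ) * v + D.mu i)‖) = K₀ := by
    have eu := hlogγ (x := 3 / 4) (by norm_num) (by norm_num)
    have ev := hlogγ (x := 1 / 4) (by norm_num) (by norm_num)
    rw [Finset.sum_sub_distrib, hK₀]
    simp only [← hu, ← hv] at eu ev ⊢
    rw [hsym1, hsym2] at eu
    linarith
  -- but each difference is `≥ (ωᵢ/2) log |ηᵢ| − 2Cᵢ ≥ M`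
  have hdiff : ∀ i, M ≤ Real.log ‖Complex.Gamma ((D.omega i : ℂ) * u + D.mu i)‖ -
      Real.log ‖Complex.Gamma ((D.omega i : ℂ) * v + D.mu i)‖ := by
    intro i
    obtain ⟨hη1, hηM⟩ := hyall i
    set η : ℝ := D.omega i * y + (D.mu i).im with hη
    set x₁ : ℝ := D.omega i * (3 / 4) + (D.mu i).re with hx₁
    set x₂ : ℝ := D.omega i * (1 / 4) + (D.mu i).re with hx₂
    have e1 : (D.omega i : ℂ) * u + D.mu i = (x₁ : ℂ) + η * I := by
      rw [hu, omega_mul_add_mu_eq]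
    have e2 : (D.omega i : ℂ) * v + D.mu i = (x₂ : ℂ) + η * I := by
      rw [hv, omega_mul_add_mu_eq]
    rw [e1, e2]
    have hω := D.omega_pos i
    have hx₁I : x₁ ∈ Icc (D.omega i / 4 + (D.mu i).re) (3 * D.omega i / 4 + (D.mu i).re) := by
      rw [hx₁]; constructor <;> linarith
    have hx₂I : x₂ ∈ Icc (D.omega i / 4 + (D.mu i).re) (3 * D.omega i / 4 + (D.mu i).re) := by
      rw [hx₂]; constructor <;> linarith
    have h1 := abs_le.1 (hC i x₁ hx₁I η hη1)
    have h2 := abs_le.1 (hC i x₂ hx₂I η hη1)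
    have hx12 : x₁ - x₂ = D.omega i / 2 := by rw [hx₁, hx₂]; ring
    have hlog0 : 0 ≤ Real.log |η| := Real.log_nonneg hη1
    nlinarith [h1.1, h1.2, h2.1, h2.2]
  have hMK : K₀ + 1 ≤ M := le_max_left _ _
  have hM0 : 0 ≤ M := le_max_right _ _
  haveI : Nonempty (Fin D.numGamma) := ⟨⟨0, hk⟩⟩
  have hge : M ≤ ∑ i, (Real.log ‖Complex.Gamma ((D.omega i : ℂ) * u + D.mu i)‖ -
      Real.log ‖Complex.Gamma ((D.omega i : ℂ) * v + D.mu i)‖) := by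
    calc M = ∑ i ∈ ({⟨0, hk⟩} : Finset (Fin D.numGamma)), M := by simp
      _ ≤ ∑ i, M := Finset.sum_le_sum_of_subset_of_nonneg (Finset.subset_univ _) (fun i _ _ ↦ hM0)
      _ ≤ _ := Finset.sum_le_sum fun i _ ↦ hdiff i
  rw [hsum] at hge
  linarith


/-! ### Dobner's Lemma 3 for `F ∈ 𝒮♯` -/

/-- The `e^{(t/4) log² n}`-weights are non-zero. [folklore] -/
private theorem zetaDeformedCoeff_ne_zero (t : ℝ) (n : ℕ) : zetaDeformedCoeff t n ≠ 0 := by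
  rw [zetaDeformedCoeff]; exact Complex.ofReal_ne_zero.2 (Real.exp_pos _).ne'

/-- **Dobner's Lemma 3** ("For any `t < 0`, `F_t` has a zero", for `F ∈ 𝒮♯`): for a datum of
`𝒮♯` with at least one `Γ`-factor and every `t < 0`, the entire function `F_t` has a zero.
Proof as printed (§5 p. 16): `F_t` has order `≤ 2` and is bounded on every right half-plane, so a
zero-free `F_t` is `e^{ρ + bs}` with `b` real, `b ≤ 0` (here via Borel–Carathéodory + Cauchy,
`Literature.NumberTheory.LFunctions.quadratic_coeffs_of_bounded`, instead of Hadamard); letting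
`s → +∞` along the reals after multiplying by `n₁ˢ` (`n₁` the first non-zero coefficient) forces
`F_t(s) = c n₁^{−s}`, i.e. a single non-zero coefficient (uniqueness of Dirichlet coefficients),
contradicting `Literature.NumberTheory.LFunctions.ExtendedSelbergDatum.exists_coeff_ne_zero_ne`
(the point the printed proof leaves tacit). [cite: Dobner2021, Lemma 3 (§3 p. 9; proof §5 p. 16)] -/
theorem Ft_exists_zero (hk : 0 < D.numGamma) {t : ℝ} (ht : t < 0) : ∃ s : ℂ, D.Ft t s = 0 := by
  by_contra hno
  push Not at hno
  have hd := D.differentiable_Ft ht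
  -- `F_t = e^g`, `g` a quadratic polynomial
  obtain ⟨g, hg, hfg⟩ := exists_entire_log hd hno
  obtain ⟨S, hS, hgrowth⟩ := D.exists_norm_Ft_le_exp_sq ht
  have hre : ∀ z : ℂ, (g z).re ≤ 4 / |t| * ‖z‖ ^ 2 + Real.log S := by
    intro z
    have h1 : Real.exp ((g z).re) = ‖D.Ft t z‖ := by rw [hfg z, Complex.norm_exp]
    have h3 : Real.exp ((g z).re) ≤ Real.exp (Real.log S + 4 / |t| * ‖z‖ ^ 2) := by
      rw [h1, Real.exp_add, Real.exp_log hS]; exact hgrowth z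
    have := Real.exp_le_exp.1 h3
    linarith
  have htpos : 0 < |t| := abs_pos.2 ht.ne
  obtain ⟨K, -, hK⟩ := exists_norm_le_sq_of_re_le hg (by positivity) hre
  have h3 := iteratedDeriv_three_eq_zero hg hK
  have hquad := eq_quadratic_of_iteratedDeriv_three hg h3
  set a : ℂ := deriv (deriv g) 0 / 2 with ha
  set b : ℂ := deriv g 0 with hb
  set ρ : ℂ := g 0 with hρ
  have hgq : ∀ z, g z = a * z ^ 2 + b * z + ρ := fun z ↦ by rw [hquad z]; ring
  -- boundedness on right half-planes ⇒ `a = 0`, `b` real `≤ 0`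
  have hbd : ∀ c : ℝ, ∃ B : ℝ, ∀ s : ℂ, c ≤ s.re → (a * s ^ 2 + b * s + ρ).re ≤ B := by
    intro c
    obtain ⟨B, hB⟩ := D.exists_norm_Ft_le_of_le_re ht c
    have hBpos : 0 < B := (norm_pos_iff.2 (hno c)).trans_le (hB c (by simp))
    refine ⟨Real.log B, fun s hs ↦ ?_⟩
    have h1 : Real.exp ((a * s ^ 2 + b * s + ρ).re) = ‖D.Ft t s‖ := by
      rw [hfg s, Complex.norm_exp, hgq s]
    have := hB s hs
    rw [← h1] at this
    exact (Real.le_log_iff_exp_le hBpos).2 this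
  obtain ⟨ha0, hbim, -⟩ := quadratic_coeffs_of_bounded hbd
  have hform : ∀ x : ℝ, D.Ft t x = Complex.exp ρ * Complex.exp (b * x) := by
    intro x
    rw [hfg x, hgq, ha0, zero_mul, zero_add, add_comm, Complex.exp_add]
  have hbre : b = (b.re : ℂ) := Complex.ext (by simp) (by simp [hbim])
  -- the coefficient function with `f 0 = 0`
  set f : ℕ → ℂ := fun n ↦ if n = 0 then 0 else D.deformedCoeff t n with hf
  have hfne : ∀ {n : ℕ}, n ≠ 0 → f n = D.deformedCoeff t n := fun {n} hn ↦ by simp [hf, hn]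
  have hfF : ∀ s : ℂ, LSeries f s = D.Ft t s := fun s ↦ LSeries_congr (fun {n} hn ↦ hfne hn) s
  have hfabs : LSeries.abscissaOfAbsConv f < ⊤ := by
    rw [LSeries.abscissaOfAbsConv_congr (g := D.deformedCoeff t) (fun {n} hn ↦ hfne hn),
      D.abscissaOfAbsConv_deformedCoeff ht]
    exact bot_lt_top
  -- the first non-zero coefficient `n₁ = n + 1`
  obtain ⟨n₂, hn₂0, -, hn₂⟩ := D.exists_coeff_ne_zero_ne hk 0
  have hex : ∃ m, f m ≠ 0 :=
    ⟨n₂, by rw [hfne hn₂0, deformedCoeff]; exact mul_ne_zero (zetaDeformedCoeff_ne_zero t n₂) hn₂⟩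
  classical
  have hn₁ : f (Nat.find hex) ≠ 0 := Nat.find_spec hex
  have hmin : ∀ m < Nat.find hex, f m = 0 := fun m hm ↦ by
    have := Nat.find_min hex hm; rwa [not_not] at this
  have hn₁0 : Nat.find hex ≠ 0 := fun h ↦ hn₁ (by rw [h]; simp [hf])
  obtain ⟨n, hn⟩ : ∃ n : ℕ, Nat.find hex = n + 1 := Nat.exists_eq_add_one_of_ne_zero hn₁0
  rw [hn] at hn₁ hmin
  have hlim := LSeries.tendsto_cpow_mul_atTop (f := f) (n := n)
    (fun m hm ↦ hmin m (Nat.lt_succ_of_le hm)) hfabs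
  -- `(n+1)^x F_t(x) = e^ρ e^{βx}` with `β = Re b + log (n+1)`
  set β : ℝ := b.re + Real.log (n + 1) with hβ
  have hn1pos : (0 : ℝ) < n + 1 := by positivity
  have hprod : ∀ x : ℝ, (n + 1 : ℂ) ^ (x : ℂ) * LSeries f x =
      Complex.exp ρ * Complex.exp ((β : ℂ) * x) := by
    intro x
    have hc : (n + 1 : ℂ) ^ (x : ℂ) = Complex.exp ((Real.log (n + 1) : ℂ) * x) := by
      rw [show (n + 1 : ℂ) = ((n + 1 : ℝ) : ℂ) by push_cast; ring, ← Complex.ofReal_cpow hn1pos.le,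
        Real.rpow_def_of_pos hn1pos, Complex.ofReal_exp]
      push_cast; ring_nf
    rw [hfF, hform x, hc]
    conv_lhs => rw [hbre]
    rw [← Complex.exp_add, ← Complex.exp_add, ← Complex.exp_add]
    congr 1
    rw [hβ]
    push_cast
    ring
  have hnorm : ∀ x : ℝ, ‖Complex.exp ρ * Complex.exp ((β : ℂ) * x)‖ = Real.exp ρ.re * Real.exp (β * x) := by
    intro x
    rw [norm_mul, Complex.norm_exp, Complex.norm_exp]
    simp
  have hlim' : Tendsto (fun x : ℝ ↦ Complex.exp ρ * Complex.exp ((β : ℂ) * x)) atTop (nhds (f (n + 1))) :=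
    hlim.congr fun x ↦ hprod x
  -- `β = 0`
  have hβ0 : β = 0 := by
    rcases lt_trichotomy β 0 with hlt | heq | hgt
    · exfalso
      have hto0 : Tendsto (fun x : ℝ ↦ Complex.exp ρ * Complex.exp ((β : ℂ) * x)) atTop (nhds 0) := by
        have h1 : Tendsto (fun x : ℝ ↦ Complex.exp ρ * Complex.exp ((β : ℂ) * x)) atTop
            (nhds (Complex.exp ρ * 0)) := by
          refine Tendsto.const_mul _ ?_
          rw [tendsto_zero_iff_norm_tendsto_zero]
          have e : (fun x : ℝ ↦ ‖Complex.exp ((β : ℂ) * x)‖) = fun x : ℝ ↦ Real.exp (β * x) := by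
            funext x; rw [Complex.norm_exp]; simp
          rw [e]
          exact Real.tendsto_exp_atBot.comp (tendsto_id.const_mul_atTop_of_neg hlt)
        rwa [mul_zero] at h1
      exact hn₁ (tendsto_nhds_unique hlim' hto0)
    · exact heq
    · exfalso
      have hT : Tendsto (fun x : ℝ ↦ ‖Complex.exp ρ * Complex.exp ((β : ℂ) * x)‖) atTop atTop := by
        simp_rw [hnorm]
        exact (Real.tendsto_exp_atTop.comp (tendsto_id.const_mul_atTop hgt)).const_mul_atTop
          (Real.exp_pos _)
      exact (hlim'.norm.not_tendsto (disjoint_nhds_atTop _)) hT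
  -- hence `f (n+1) = e^ρ` and `F_t(x) = f(n+1) (n+1)^{-x}`
  have hconst : ∀ x : ℝ, Complex.exp ρ * Complex.exp ((β : ℂ) * x) = Complex.exp ρ := fun x ↦ by
    rw [hβ0]; simp
  have hρeq : f (n + 1) = Complex.exp ρ :=
    (tendsto_nhds_unique hlim' (tendsto_const_nhds.congr fun x ↦ (hconst x).symm))
  -- the single-term comparison series
  set g₁ : ℕ → ℂ := fun m ↦ if m = n + 1 then f (n + 1) else 0 with hg₁
  have hg₁abs : LSeries.abscissaOfAbsConv g₁ < ⊤ := by
    have hsum : LSeriesSummable g₁ 0 := by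
      refine summable_of_ne_finset_zero (s := {n + 1}) fun m hm ↦ ?_
      rw [Finset.mem_singleton] at hm
      rcases Nat.eq_zero_or_pos m with h0 | hpos
      · rw [h0, LSeries.term_zero]
      · rw [LSeries.term_of_ne_zero hpos.ne', hg₁]; simp [hm]
    exact hsum.abscissaOfAbsConv_le.trans_lt (by simp)
  have hg₁L : ∀ x : ℝ, LSeries g₁ x = f (n + 1) / (n + 1 : ℂ) ^ (x : ℂ) := by
    intro x
    rw [LSeries, tsum_eq_single (n + 1)]
    · rw [LSeries.term_of_ne_zero (Nat.succ_ne_zero n), hg₁]; simp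
    · intro m hm
      rcases Nat.eq_zero_or_pos m with h0 | hpos
      · rw [h0, LSeries.term_zero]
      · rw [LSeries.term_of_ne_zero hpos.ne', hg₁]; simp [hm]
  have hcpow_ne : ∀ x : ℝ, (n + 1 : ℂ) ^ (x : ℂ) ≠ 0 := fun x ↦ by
    rw [Ne, Complex.cpow_eq_zero_iff, not_and_or]
    exact Or.inl (by exact_mod_cast hn1pos.ne')
  have heq : (fun x : ℝ ↦ LSeries f x) =ᶠ[atTop] fun x : ℝ ↦ LSeries g₁ x := by
    refine Eventually.of_forall fun x ↦ ?_
    have h1 := hprod x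
    rw [hconst x, ← hρeq] at h1
    show LSeries f x = LSeries g₁ x
    rw [hg₁L x, eq_div_iff (hcpow_ne x), mul_comm]
    exact h1
  -- so every other coefficient vanishes — contradiction
  obtain ⟨m, hm0, hmn, hm⟩ := D.exists_coeff_ne_zero_ne hk (n + 1)
  have h2 := LSeries.eq_of_LSeries_eventually_eq hfabs hg₁abs heq hm0
  have h2' : D.deformedCoeff t m = 0 := by rw [hfne hm0] at h2; rw [h2, hg₁]; simp [hmn]
  rw [deformedCoeff] at h2'
  exact hm ((mul_eq_zero.1 h2').resolve_left (zetaDeformedCoeff_ne_zero t m))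

end ExtendedSelbergDatum

end Literature.NumberTheory.LFunctions

end
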